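import Literature.MathematicalPhysics.QuantumLattice.FinDimSpectrum
import Literature.LinearAlgebra.Matrix.PosSemidefTrace

/-!
# Route `BalabanIR`, crux `BirGroundStateAverageLRO` (item `stmt-HubbardSuperconductivity-2079`), line `Sketch` (softmin-pair-penalty): stub `stub_sectorEnergyNonneg`

"The sector Gibbs state sits above the sector energy." For an idempotent Hermitian `P` (a
symmetry sector), a positive semidefinite `W` commuting with `P` (the un-normalised sector Gibbs
weight `e^{-βK'}` of the penalised Hamiltonian), a Hermitian `H` and a real `e` below the Rayleigh
quotients of `H` on the unit vectors of `range P`,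

  `0 ≤ Re tr (P W (H - e·1))`.

Proof (folklore finite-dimensional linear algebra): the lower bound on the unit vectors of the
sector is the lower bound `e · Re ⟨v, v⟩ ≤ Re ⟨v, H v⟩` on the whole sector
(`sectorEnergy_mul_le_re_quadForm`, normalise `v ≠ 0`), so the compression `X = P (H - e) P` is
positive semidefinite (`posSemidef_proj_mul_mul_proj`); by `P² = P`, `P W = W P` and cyclicity of
the trace, `tr (P W (H - e)) = tr (W X)`, and `Re tr (W X) ≥ 0` for `W, X ⪰ 0`
(`Literature.LinearAlgebra.Matrix.re_trace_mul_nonneg_of_posSemidef`). Used in `softmin_chain` of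
the line skeleton `Cruxes/BirGroundStateAverageLRO/Lines/Sketch.lean` (second inequality of the
lever: the sector Gibbs state of the penalised torus has `H`-expectation `≥ e`).

Source: H. Tasaki, *Physics and Mathematics of Quantum Many-Body Systems* (2020), App. A and §2.2
(variational characterisation of sector energies; Gibbs states). Folklore; no definition is
introduced.
-/

noncomputable section

namespace Summit.HubbardSuperconductivity.HubbardSuperconductivity.Theorems.BirGroundStateAverageLRO.Softmin

open Matrix Finset Literature.MathematicalPhysics.QuantumLattice
open scoped ComplexOrder

variable {n : Type*} [Fintype n] [DecidableEq n]

omit [DecidableEq n] in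
/-- Normalisation by a positive real scalar: a nonzero vector `v` has the unit multiple `c • v`,
`c = (√(Re ⟨v, v⟩))⁻¹ > 0`, and `c² · Re ⟨v, v⟩ = 1`. [folklore] -/
theorem exists_real_smul_unit_of_ne_zero {v : n → ℂ} (hv : v ≠ 0) :
    ∃ c : ℝ, 0 < c ∧ star ((c : ℂ) • v) ⬝ᵥ ((c : ℂ) • v) = 1 ∧
      c ^ 2 * (star v ⬝ᵥ v).re = 1 := by
  obtain ⟨hre, him⟩ := Complex.pos_iff.mp (dotProduct_star_self_pos_iff.2 hv)
  have hc : (Real.sqrt (star v ⬝ᵥ v).re)⁻¹ ^ 2 * (star v ⬝ᵥ v).re = 1 := by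
    rw [inv_pow, Real.sq_sqrt hre.le, inv_mul_cancel₀ hre.ne']
  refine ⟨(Real.sqrt (star v ⬝ᵥ v).re)⁻¹, inv_pos.2 (Real.sqrt_pos.2 hre), ?_, hc⟩
  rw [star_smul, smul_dotProduct, dotProduct_smul, smul_smul, smul_eq_mul, Complex.star_def,
    Complex.conj_ofReal, ← Complex.ofReal_mul, ← sq]
  refine Complex.ext ?_ ?_
  · rw [Complex.re_ofReal_mul, Complex.one_re, hc]
  · rw [Complex.im_ofReal_mul, Complex.one_im, ← him, mul_zero]

omit [DecidableEq n] in
/-- A lower bound `e` of the Rayleigh quotient `Re ⟨φ, H φ⟩` on the unit vectors fixed by `P` is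
the lower bound `e · Re ⟨v, v⟩ ≤ Re ⟨v, H v⟩` on every vector fixed by `P` (scale `v ≠ 0` to a
unit vector, which `P` still fixes). [folklore] -/
theorem sectorEnergy_mul_le_re_quadForm {P H : Matrix n n ℂ} {e : ℝ}
    (he : ∀ φ : n → ℂ, P *ᵥ φ = φ → star φ ⬝ᵥ φ = 1 → e ≤ (star φ ⬝ᵥ (H *ᵥ φ)).re)
    (v : n → ℂ) (hv : P *ᵥ v = v) : e * (star v ⬝ᵥ v).re ≤ (star v ⬝ᵥ (H *ᵥ v)).re := by
  by_cases hv0 : v = 0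
  · subst hv0
    simp
  obtain ⟨c, -, hc1, hcc⟩ := exists_real_smul_unit_of_ne_zero hv0
  have hPc : P *ᵥ ((c : ℂ) • v) = (c : ℂ) • v := by rw [mulVec_smul, hv]
  have h1 := he _ hPc hc1
  rw [star_smul, mulVec_smul, smul_dotProduct, dotProduct_smul, smul_smul, smul_eq_mul,
    Complex.star_def, Complex.conj_ofReal, ← Complex.ofReal_mul, Complex.re_ofReal_mul, ← sq] at h1
  have hr0 : 0 ≤ (star v ⬝ᵥ v).re := (Complex.nonneg_iff.mp (dotProduct_star_self_nonneg v)).1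
  calc e * (star v ⬝ᵥ v).re ≤ c ^ 2 * (star v ⬝ᵥ (H *ᵥ v)).re * (star v ⬝ᵥ v).re :=
        mul_le_mul_of_nonneg_right h1 hr0
    _ = (star v ⬝ᵥ (H *ᵥ v)).re * (c ^ 2 * (star v ⬝ᵥ v).re) := by ring
    _ = (star v ⬝ᵥ (H *ᵥ v)).re := by rw [hcc, mul_one]

omit [DecidableEq n] in
/-- If the quadratic form of a Hermitian `M` is nonnegative on the vectors fixed by an idempotent
Hermitian `P`, then the compression `P M P` is positive semidefinite
(`⟨x, P M P x⟩ = ⟨P x, M (P x)⟩` and `P (P x) = P x`). [folklore] -/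
theorem posSemidef_proj_mul_mul_proj {P M : Matrix n n ℂ} (hP : P * P = P) (hPh : P.IsHermitian)
    (hM : M.IsHermitian) (hq : ∀ φ : n → ℂ, P *ᵥ φ = φ → 0 ≤ star φ ⬝ᵥ (M *ᵥ φ)) :
    (P * M * P).PosSemidef := by
  have hherm : (P * M * P).IsHermitian := by
    have h := isHermitian_conjTranspose_mul_mul P hM
    rwa [hPh.eq] at h
  refine PosSemidef.of_dotProduct_mulVec_nonneg hherm fun x => ?_
  have hfix : P *ᵥ (P *ᵥ x) = P *ᵥ x := by rw [mulVec_mulVec, hP]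
  have hstar : star x ᵥ* P = star (P *ᵥ x) := by rw [star_mulVec, hPh.eq]
  rw [← mulVec_mulVec, ← mulVec_mulVec, dotProduct_mulVec, hstar]
  exact hq _ hfix

/-- **The sector Gibbs state sits above the sector energy** (stub `stub_sectorEnergyNonneg` of
line `Sketch`). For an idempotent Hermitian `P`, a positive semidefinite `W` commuting with `P`, a
Hermitian `H` and a real `e` below the Rayleigh quotients of `H` on the unit vectors of `range P`:
`0 ≤ Re tr (P W (H - e·1))` (`tr (P W (H - e)) = tr (W · P (H - e) P)` by `P² = P`, `P W = W P`
and cyclicity; `P (H - e) P ⪰ 0`, `W ⪰ 0`). Tasaki (2020) App. A, §2.2. [folklore] -/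
theorem stub_sectorEnergyNonneg (P W H : Matrix n n ℂ) (hP : P * P = P) (hPh : P.IsHermitian)
    (hPW : Commute P W) (hW : W.PosSemidef) (hH : H.IsHermitian) (e : ℝ)
    (he : ∀ φ : n → ℂ, P *ᵥ φ = φ → star φ ⬝ᵥ φ = 1 → e ≤ (star φ ⬝ᵥ (H *ᵥ φ)).re) :
    0 ≤ (P * W * (H - ((e : ℝ) : ℂ) • (1 : Matrix n n ℂ))).trace.re := by
  set M : Matrix n n ℂ := H - ((e : ℝ) : ℂ) • (1 : Matrix n n ℂ) with hMdef
  have hM : M.IsHermitian := by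
    refine IsHermitian.sub hH ?_
    unfold Matrix.IsHermitian
    rw [conjTranspose_smul, conjTranspose_one, Complex.star_def, Complex.conj_ofReal]
  -- the quadratic form of `H - e` is nonnegative on the sector
  have hq : ∀ φ : n → ℂ, P *ᵥ φ = φ → 0 ≤ star φ ⬝ᵥ (M *ᵥ φ) := by
    intro φ hφ
    have hlb := sectorEnergy_mul_le_re_quadForm he φ hφ
    have hexp : star φ ⬝ᵥ (M *ᵥ φ) = star φ ⬝ᵥ (H *ᵥ φ) - ((e : ℝ) : ℂ) * (star φ ⬝ᵥ φ) := by
      rw [hMdef, sub_mulVec, smul_mulVec, one_mulVec, dotProduct_sub, dotProduct_smul,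
        smul_eq_mul]
    rw [Complex.nonneg_iff]
    refine ⟨?_, ?_⟩
    · rw [hexp, Complex.sub_re, Complex.re_ofReal_mul, sub_nonneg]
      exact hlb
    · have him := hM.im_star_dotProduct_mulVec_self φ
      rw [RCLike.im_to_complex] at him
      exact him.symm
  -- `X = P (H - e) P ⪰ 0`
  have hX : (P * M * P).PosSemidef := posSemidef_proj_mul_mul_proj hP hPh hM hq
  -- `tr (P W (H - e)) = tr (W X)` by `P² = P`, `P W = W P` and cyclicity
  have htr : (P * W * M).trace = (W * (P * M * P)).trace := by
    calc (P * W * M).trace = (P * (P * W * M)).trace := by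
          rw [← Matrix.mul_assoc, ← Matrix.mul_assoc, hP]
      _ = (P * W * M * P).trace := trace_mul_comm _ _
      _ = (W * (P * M * P)).trace := by
          rw [hPW.eq]
          simp only [Matrix.mul_assoc]
  rw [htr]
  exact Literature.LinearAlgebra.Matrix.re_trace_mul_nonneg_of_posSemidef hW hX

end Summit.HubbardSuperconductivity.HubbardSuperconductivity.Theorems.BirGroundStateAverageLRO.Softmin
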